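import Summits.Parity.GeneralizedHardyLittlewood.Theorems.LeeYangFibresCellParityLawSieveDefs
import Summits.Parity.GeneralizedHardyLittlewood.Theorems.LeeYangFibresCellParityLawSingularRatio
import Summits.Parity.GeneralizedHardyLittlewood.Theorems.LeeYangFibresCellParityLawModelDensityBounds
import Summits.Parity.GeneralizedHardyLittlewood.Theorems.LeeYangFibresCellParityLawEulerRatio
import Literature.NumberTheory.Sieve.SieveFunctions
import Literature.NumberTheory.Sieve.SieveFramework
import Literature.NumberTheory.Sieve.McCurleyCoveringEstimates
import HarnessLib

/-!
# Route `LeeYangFibres`, crux `CellParityLaw` (stmt-Parity-14109), line `section-annihilator`: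
# the registered stub `stub_prLawTwoAssembly` — the `u = 2` rung of Bombieri's `P_r` law, assembled

We prove `PrLawTwoAssembly` (vocabulary file `LeeYangFibresCellParityLawSieveDefs`): the Euler-ratio
identity, the elementary preparations (`PrLawTwoPrep`), the top-cell bound (`PrLawTwoTopCell`) and the sharp
prime-cell bound (`PrLawTwoMainCell`) give Bombieri's `P_r` law for the sections at roughness `u = 2`,
`SectionPrLawAtU 2 t`, from the atom `SectionLevelAt t`.

At `u = 2` the model density of the top cell vanishes (`a_2 = 0`: a product of two primes `> N^{1/2}` exceeds
`N`; `modelDensity_eq_zero`), so the law asks, for each coordinate section, for ONE `δ ∈ [0, 2]` with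
`|C_{(1,j')} - (2 - δ) a_1 H F| ≤ E` and `C_{(2,j')} ≤ E`, `E = N/(log^{t+1} N (log log N)^B)`. In the
non-degenerate case (no degenerate prime of the section density, no local obstruction of the frozen
sub-system, so that `H = 𝔖(Ψ)/𝔖(Ψ₋ᵢ) ≥ 0`) the prime-cell bound `C_{(1,j')} ≤ 2 a_1 H F + E` lets us take
`δ = 2 - C_{(1,j')}/(a_1 H F)` clipped to `[0, 2]` (error `0` or `C - 2 a_1 H F ≤ E`), and the top-cell bound
is the case `m = 2`. In the degenerate cases every cell and the factor `H · F` vanish (`PrLawTwoPrep` (a)).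
This is pure bookkeeping; the sieve lives in the two cell bounds.

References: E. Bombieri, RIMS Kôkyûroku 294 (1977) p. 5 [BombieriRIMS1977]; H. Iwaniec, Acta Arith. 36 (1980)
Thm 1 [IwaniecActaArith1980].
-/

noncomputable section

open scoped BigOperators Topology Classical
open Finset Filter Literature.NumberTheory.Sieve

namespace Summit.Parity.GeneralizedHardyLittlewood.Cruxes.CellParityLaw.SectionAnnihilator


namespace PrLawTwoAssemblyAux

variable {t : ℕ}

/-- The section density never exceeds `1` at a prime: `g(p) = (g'_p - g_p)/g'_p` with `0 ≤ g_p ≤ g'_p`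
(and Lean's `x/0 = 0`). -/
theorem sectionDensity_prime_le_one (Ψ : Fin (t + 1) → AffLinForm 1) (i : Fin (t + 1)) {p : ℕ}
    (hp : p.Prime) : sectionDensity Ψ i p ≤ 1 := by
  haveI := Fact.mk hp
  rw [EulerRatioAux.sectionDensity_prime Ψ i]
  have hG : (0 : ℝ) ≤ (goodCount Ψ p : ℝ) := Nat.cast_nonneg _
  rcases Nat.eq_zero_or_pos (goodCount (Fin.removeNth i Ψ) p) with h0 | hpos
  · rw [h0, Nat.cast_zero, div_zero]; exact zero_le_one
  · have hpos' : (0 : ℝ) < (goodCount (Fin.removeNth i Ψ) p : ℝ) := by exact_mod_cast hpos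
    rw [div_le_one hpos']; linarith

/-- The budget `N/(log^{t+1} N (log log N)^B)` is non-negative for `N ≥ 3`. -/
theorem budget_nonneg {N : ℕ} (hN : 3 ≤ N) (t B : ℕ) :
    0 ≤ (N : ℝ) / (Real.log N ^ (t + 1) * Real.log (Real.log N) ^ B) := by
  have hN3 : (3 : ℝ) ≤ N := by exact_mod_cast hN
  have hlog : 1 ≤ Real.log N := by
    rw [Real.le_log_iff_exp_le (by linarith)]
    exact (Real.exp_one_lt_d9.le.trans (by norm_num)).trans hN3
  have hll : 0 ≤ Real.log (Real.log N) := Real.log_nonneg hlog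
  positivity

/-! ### Elementary asymptotics in `N` shared with the prime-cell bound (`…PrLawTwoMainCell`) -/

/-- Eventually `c ≤ log log N` (`log log N → ∞` along the naturals: the tree's
`McCurley.tendsto_loglog_natCast`). -/
theorem eventually_le_loglog (c : ℝ) : ∀ᶠ N : ℕ in atTop, c ≤ Real.log (Real.log (N : ℝ)) :=
  Literature.NumberTheory.Sieve.McCurley.tendsto_loglog_natCast.eventually_ge_atTop c

/-- Powers of `log log N` are eventually below any positive multiple of `log N`:
`(log log N)^n ≤ c log N` (from `(log x)^n/x → 0` at `x = log N`). -/
theorem eventually_loglog_pow_le (n : ℕ) {c : ℝ} (hc : 0 < c) :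
    ∀ᶠ N : ℕ in atTop, Real.log (Real.log (N : ℝ)) ^ n ≤ c * Real.log (N : ℝ) := by
  have h1 : Tendsto (fun x : ℝ => Real.log x ^ n / (1 * x + 0)) atTop (𝓝 0) :=
    Real.tendsto_pow_log_div_mul_add_atTop 1 0 n one_ne_zero
  have h2 : Tendsto (fun N : ℕ => Real.log (Real.log (N : ℝ)) ^ n / (1 * Real.log (N : ℝ) + 0)) atTop
      (𝓝 0) := h1.comp (Real.tendsto_log_atTop.comp tendsto_natCast_atTop_atTop)
  have h3 : ∀ᶠ N : ℕ in atTop, Real.log (Real.log (N : ℝ)) ^ n / (1 * Real.log (N : ℝ) + 0) ≤ c :=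
    (h2.eventually (eventually_le_nhds hc)).mono fun N hN => hN
  have h4 : ∀ᶠ N : ℕ in atTop, (1 : ℝ) ≤ Real.log (N : ℝ) :=
    (Real.tendsto_log_atTop.comp tendsto_natCast_atTop_atTop).eventually_ge_atTop 1
  filter_upwards [h3, h4] with N hN hl
  rw [one_mul, add_zero, div_le_iff₀ (by linarith)] at hN
  exact hN

/-- Any fixed multiple of a power of `log log N` is eventually below `log N`. -/
theorem eventually_const_mul_loglog_pow_le (n : ℕ) (c : ℝ) (hc : 0 ≤ c) :
    ∀ᶠ N : ℕ in atTop, c * Real.log (Real.log (N : ℝ)) ^ n ≤ Real.log N := by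
  filter_upwards [eventually_loglog_pow_le n (c := 1 / (c + 1)) (by positivity),
    (Real.tendsto_log_atTop.comp tendsto_natCast_atTop_atTop).eventually_ge_atTop (0 : ℝ)] with N hN hl0
  have hl0' : (0 : ℝ) ≤ Real.log (N : ℝ) := hl0
  have hc1 : 0 < c + 1 := by linarith
  calc c * Real.log (Real.log (N : ℝ)) ^ n ≤ c * (1 / (c + 1) * Real.log N) := by gcongr
    _ = c / (c + 1) * Real.log N := by ring
    _ ≤ 1 * Real.log N := by
        apply mul_le_mul_of_nonneg_right _ hl0'
        rw [div_le_one hc1]; linarith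
    _ = Real.log N := one_mul _

/-- From `A³ ≤ w` with `A, w > 0`: `w^{-1/3} ≤ A⁻¹`. -/
theorem rpow_neg_third_le {A w : ℝ} (hA : 0 < A) (hw : 0 < w) (h : A ^ 3 ≤ w) :
    w ^ (-(1 / 3 : ℝ)) ≤ A⁻¹ := by
  have h3 : (A ^ 3) ^ ((3 : ℕ)⁻¹ : ℝ) ≤ w ^ ((3 : ℕ)⁻¹ : ℝ) :=
    Real.rpow_le_rpow (by positivity) h (by positivity)
  rw [Real.pow_rpow_inv_natCast hA.le (by norm_num)] at h3
  have e : ((3 : ℕ)⁻¹ : ℝ) = 1 / 3 := by norm_num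
  rw [e] at h3
  rw [Real.rpow_neg hw.le]
  exact inv_anti₀ hA h3

end PrLawTwoAssemblyAux

open PrLawTwoAssemblyAux in
/-- **`stub_prLawTwoAssembly`** (registered stub of the line `section-annihilator`, skeleton v9): the `u = 2`
rung `PrLawTwoAssembly` — `δ = 2 - C_{(1,j')}/(a_1 H F)` clipped to `[0,2]` in the non-degenerate case (from
the prime-cell bound `C_{(1,j')} ≤ 2 a_1 H F + E` and the top-cell bound `C_{(2,j')} ≤ E`, `a_2 = 0`), and
empty cells with a vanishing model factor otherwise. -/
theorem stub_prLawTwoAssembly : PrLawTwoAssembly := by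
  intro hF hD hM hE hP hTop hMain t ht hA L B
  obtain ⟨Ndeg, hdeg⟩ := hP.1 t L 2 le_rfl
  obtain ⟨N₁, hN₁⟩ := hTop hF hD hM hP t ht hA L B
  obtain ⟨N₂, hN₂⟩ := hMain hF hD hM hE hP t ht hA L B
  refine ⟨max Ndeg (max N₁ (max N₂ 3)), fun N hN Ψ hΨ hL K hK hKN i j' hj' => ?_⟩
  have hNdeg : Ndeg ≤ N := le_trans (le_max_left _ _) hN
  have hN1 : N₁ ≤ N := le_trans ((le_max_left _ _).trans (le_max_right _ _)) hN
  have hN2 : N₂ ≤ N := le_trans (((le_max_left _ _).trans (le_max_right _ _)).trans (le_max_right _ _)) hN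
  have hN3 : 3 ≤ N := le_trans (((le_max_right _ _).trans (le_max_right _ _)).trans (le_max_right _ _)) hN
  set E : ℝ := (N : ℝ) / (Real.log N ^ (t + 1) * Real.log (Real.log N) ^ B) with hEdef
  have hE0 : 0 ≤ E := budget_nonneg hN3 t B
  have ha2 : modelDensity N 2 2 = 0 := modelDensity_eq_zero (by norm_num) le_rfl
  by_cases hdg : (∃ p : ℕ, p.Prime ∧ sectionDensity Ψ i p = 1) ∨ singularProduct (Fin.removeNth i Ψ) = 0
  · -- degenerate: every cell and the factor `H · F` vanish
    obtain ⟨hcells, hHB⟩ := hdeg N hNdeg Ψ hΨ hL K i j' hdg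
    refine ⟨1, zero_le_one, one_le_two, fun m _ _ => ?_⟩
    have hmodel : (1 + ((1 : ℝ) - 1) * (-1 : ℝ) ^ m) * modelDensity N 2 m * sectionH Ψ i *
        (sectionMass Ψ K N 2 i j' 1 : ℝ) = 0 := by
      rw [mul_assoc, hHB, mul_zero]
    rw [hcells m, hmodel, Nat.cast_zero, sub_zero, abs_zero]
    exact hE0
  · -- non-degenerate
    push Not at hdg
    obtain ⟨hne1, hS⟩ := hdg
    have hlt1 : ∀ p : ℕ, p.Prime → sectionDensity Ψ i p < 1 := fun p hp =>
      lt_of_le_of_ne (sectionDensity_prime_le_one Ψ i hp) (hne1 p hp)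
    have hc2 := hN₁ N hN1 Ψ hΨ hL K hK hKN i j' hj' hlt1 hS
    have hc1 := hN₂ N hN2 Ψ hΨ hL K hK hKN i j' hj' hlt1 hS
    set a : ℝ := modelDensity N 2 1 with ha
    set Hh : ℝ := sectionH Ψ i with hHh
    set B₁ : ℝ := (sectionMass Ψ K N 2 i j' 1 : ℝ) with hB₁
    set C₁ : ℝ := (cell Ψ K N 2 (i.insertNth 1 j') : ℝ) with hC₁
    set X : ℝ := a * Hh * B₁ with hX
    have hC₁0 : 0 ≤ C₁ := Nat.cast_nonneg _
    have hX0 : 0 ≤ X := by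
      have ha0 : 0 ≤ a := div_nonneg (Nat.cast_nonneg _) (Nat.cast_nonneg _)
      have hH0 : 0 ≤ Hh := by
        obtain ⟨NE, hNE⟩ := hE t L 2 le_rfl
        -- `H = 𝔖/𝔖'` needs `N ≥ NE`; but non-negativity holds for the limit value used there.
        -- We avoid `NE` by the identity at the level of the ratio of non-negative singular products:
        rw [hHh, EulerRatioAux.sectionH_eq Ψ hΨ i hS]
        exact div_nonneg (SingularRatio.singularProduct_nonneg hΨ)
          (SingularRatio.singularProduct_nonneg (SingularRatio.isNondegenerateSystem_removeNth hΨ i))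
      have hB0 : 0 ≤ B₁ := Nat.cast_nonneg _
      positivity
    change C₁ ≤ 2 * a * Hh * B₁ + E at hc1
    have hc1' : C₁ ≤ 2 * X + E := by rw [hX]; linarith [hc1]
    -- the top cell, for every `δ`
    have htop : ∀ δ : ℝ, |(cell Ψ K N 2 (i.insertNth 2 j') : ℝ) -
        (1 + (δ - 1) * (-1 : ℝ) ^ 2) * modelDensity N 2 2 * sectionH Ψ i *
          (sectionMass Ψ K N 2 i j' 1 : ℝ)| ≤ E := fun δ => by
      rw [ha2, mul_zero, zero_mul, zero_mul, sub_zero, abs_of_nonneg (Nat.cast_nonneg _)]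
      exact hc2
    -- choice of `δ`
    by_cases hXz : X = 0
    · refine ⟨1, zero_le_one, one_le_two, fun m hm1 hm2 => ?_⟩
      interval_cases m
      · have hmodel : (1 + ((1 : ℝ) - 1) * (-1 : ℝ) ^ 1) * modelDensity N 2 1 * sectionH Ψ i *
            (sectionMass Ψ K N 2 i j' 1 : ℝ) = X := by rw [hX]; ring
        rw [hmodel, hXz, sub_zero, abs_of_nonneg (Nat.cast_nonneg _)]
        change C₁ ≤ E
        linarith [hc1', hXz]
      · exact htop 1
    · have hXpos : 0 < X := lt_of_le_of_ne hX0 (Ne.symm hXz)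
      by_cases hle : C₁ ≤ 2 * X
      · -- `δ = 2 - C₁/X ∈ [0, 2]`, error `0`
        refine ⟨2 - C₁ / X, ?_, ?_, fun m hm1 hm2 => ?_⟩
        · have : C₁ / X ≤ 2 := by rw [div_le_iff₀ hXpos]; linarith
          linarith
        · have : 0 ≤ C₁ / X := div_nonneg hC₁0 hX0
          linarith
        · interval_cases m
          · have hmodel : (1 + ((2 - C₁ / X : ℝ) - 1) * (-1 : ℝ) ^ 1) * modelDensity N 2 1 *
                sectionH Ψ i * (sectionMass Ψ K N 2 i j' 1 : ℝ) = C₁ := by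
              have e : (1 + ((2 - C₁ / X : ℝ) - 1) * (-1 : ℝ) ^ 1) = C₁ / X := by ring
              rw [e]
              change C₁ / X * a * Hh * B₁ = C₁
              field_simp
              rw [hX]; ring
            rw [hmodel]
            change |C₁ - C₁| ≤ E
            rw [sub_self, abs_zero]; exact hE0
          · exact htop _
      · -- `δ = 0`, error `C₁ - 2X ≤ E`
        push Not at hle
        refine ⟨0, le_rfl, by norm_num, fun m hm1 hm2 => ?_⟩
        interval_cases m
        · have hmodel : (1 + ((0 : ℝ) - 1) * (-1 : ℝ) ^ 1) * modelDensity N 2 1 * sectionH Ψ i *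
              (sectionMass Ψ K N 2 i j' 1 : ℝ) = 2 * X := by rw [hX]; ring
          rw [hmodel]
          change |C₁ - 2 * X| ≤ E
          rw [abs_of_nonneg (by linarith)]
          linarith [hc1']
        · exact htop 0

end Summit.Parity.GeneralizedHardyLittlewood.Cruxes.CellParityLaw.SectionAnnihilator

end
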